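import Literature.AnabelianGeometry.EtaleTheta.EtaleThetaClass
import HarnessLib

/-!
# [EtTh] §1, Theorem 1.6: tempered anabelian rigidity of the étale theta function

Mochizuki, *The étale theta function …*, Publ. RIMS **45** (2009), §1, Thm. 1.6 and Remarks 1.6.1–1.6.4,
PRIMS PDF pp. 24–26 (printed 250–252) [cite: MochizukiEtTh2009, Thm 1.6 p.24]. Layer L2 of the
abc-iut cell, seat abc-iut-L2-t1. Typed over `ThetaSetting` / `EtaleThetaData` (`Setting.lean`,
`EtaleThetaClass.lean`) and the concrete continuous `H¹` (`ContH1.lean`); plan/FOUNDATIONS.md row 40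
(Thm. 1.6 / 1.10 are FACTs of this layer — typed, not proved).

**Shape.** Two settings `Dα`, `Dβ` ("we shall use similar notation for objects associated to
`X^log_α`, `X^log_β`", p. 24) and "an isomorphism of topological groups `γ : Π^tp_{Xα} →̃ Π^tp_{Xβ}`",
here `γ : Dα.Gtp ≃ₜ* Dβ.Gtp`. (i) is a statement about subgroups; (ii) asserts that `γ` INDUCES an
isomorphism `(Δ_Θ)α →̃ (Δ_Θ)β` — in our data model the theta quotients are carried abstractly, so
"induces" is typed as the existence of a `ThetaCompanion` of `γ` (an isomorphism of the theta quotients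
compatible with `γ` and the quotient maps, mapping `Δ_Θ` onto `Δ_Θ`) together with an isomorphism
`(K̈_α^×)^∧ →̃ (K̈_β^×)^∧` that IS the one induced on `F̈² ≅ (K̈^×)^∧` (tied to `γ` through the Kummer
classes) and preserves the kernel of the valuation surjection `↠ Ẑ` and the class of "`1 ∈ Ẑ`"
(uniformizers); (iii) uses the homomorphism `transport : H¹(Π^tp_{Ÿα}, (Δ_Θ)α) → H¹(Π^tp_{Ÿβ}, (Δ_Θ)β)`
induced by `γ` (cocycle transport `transportFun`; CONSTRUCTED): the transported theta classes of `α`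
are exactly some `Π^tp_{Xβ}/Π^tp_{Yβ} ≅ Z`-conjugate of those of `β`; the transport of cocycles IS a
cocycle (`transportFun_mem`, PROVED), giving the induced homomorphism `transport` on `H¹`.

Remarks 1.6.1–1.6.3 (pp. 25–26) are commentary (recorded as doc paragraphs below, no decl); Remark
1.6.4 (p. 26, profinite versions `(η̈^Θ)^∧ ∈ H¹(Π_Ÿ^∧, Δ_Θ)` with the `Ẑ`-action formula, preserved by
isomorphisms `Π_{Xα} →̃ Π_{Xβ}`) carries a claim but needs cohomology of the PROFINITE completion acting
on `Δ_Θ`, for which the root file has no quotient datum — recorded as a doc paragraph, not typed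
(deferred; listed so nothing is silently dropped). HONEST FRAMING: typed ≠ proved; no side taken.
-/

noncomputable section

namespace Literature.AnabelianGeometry.EtaleTheta

open Literature.AnabelianGeometry.SemiGraphs

namespace ThetaSetting

variable {p : ℕ} [Fact p.Prime] {Dα Dβ : ThetaSetting p}

/-! ### Theorem 1.6 (i) -/

/-- **Thm. 1.6 (i)** (p. 24): for an isomorphism of topological groups `γ : Π^tp_{Xα} →̃ Π^tp_{Xβ}`,
"We have: `γ(Π^tp_{Ÿα}) = Π^tp_{Ÿβ}`." [cite: MochizukiEtTh2009, Thm 1.6 (i) p.24] -/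
def Thm16i (γ : Dα.PiTemp ≃ₜ* Dβ.PiTemp) : Prop :=
  Dα.GtpYdd.map γ.toMulEquiv.toMonoidHom = Dβ.GtpYdd

/-! ### Theorem 1.6 (ii) -/

/-- A **theta companion** of `γ : Π^tp_{Xα} →̃ Π^tp_{Xβ}`: an isomorphism of the theta quotients
`(Π^tp_{Xα})^Θ →̃ (Π^tp_{Xβ})^Θ` compatible with `γ` and the quotient maps and carrying `(Δ_Θ)α` onto
`(Δ_Θ)β` — the typed form of "`γ` induces an isomorphism `(Δ_Θ)α →̃ (Δ_Θ)β`" (Thm. 1.6 (ii), p. 24; in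
print this follows because the theta quotient is defined group-theoretically from `Δ^tp_X`, which `γ`
preserves by [AbsAnab] Lem. 1.3.8). [cite: MochizukiEtTh2009, Thm 1.6 (ii) p.24] -/
structure ThetaCompanion (γ : Dα.PiTemp ≃ₜ* Dβ.PiTemp) where
  /-- the induced isomorphism of theta quotients -/
  thetaIso : Dα.GtpTheta ≃ₜ* Dβ.GtpTheta
  /-- compatibility with the quotient maps: `(·)^Θ ∘ γ = γ^Θ ∘ (·)^Θ` -/
  comm : ∀ x : Dα.PiTemp, Dβ.toTheta (γ.toMulEquiv x) = thetaIso.toMulEquiv (Dα.toTheta x)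
  /-- `γ^Θ((Δ_Θ)α) = (Δ_Θ)β` -/
  map_deltaTheta : Dα.DeltaTheta.map thetaIso.toMulEquiv.toMonoidHom = Dβ.DeltaTheta

/-- `γ⁻¹(Π^tp_{Ÿβ}) ⊆ Π^tp_{Ÿα}` under Thm. 1.6 (i). [cite: MochizukiEtTh2009, Thm 1.6 (i) p.24] -/
theorem symm_mem_GtpYdd {γ : Dα.PiTemp ≃ₜ* Dβ.PiTemp} (h : Thm16i γ) (x : Dβ.GtpYdd) :
    γ.toMulEquiv.symm x.1 ∈ Dα.GtpYdd := by
  have hx : (x : Dβ.Gtp) ∈ Dα.GtpYdd.map γ.toMulEquiv.toMonoidHom := by rw [h]; exact x.2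
  obtain ⟨y, hy, hyx⟩ := hx
  have : γ.toMulEquiv.symm x.1 = y := by
    rw [← hyx]
    exact γ.toMulEquiv.symm_apply_apply y
  rw [this]
  exact hy

/-- A theta companion carries `(Δ_Θ)α` into `(Δ_Θ)β`. [cite: MochizukiEtTh2009, Thm 1.6 (ii) p.24] -/
theorem ThetaCompanion.apply_mem {γ : Dα.PiTemp ≃ₜ* Dβ.PiTemp} (c : ThetaCompanion γ)
    (d : Dα.DeltaTheta) : c.thetaIso d.1 ∈ Dβ.DeltaTheta := by
  have hd : c.thetaIso d.1 ∈ Dα.DeltaTheta.map c.thetaIso.toMulEquiv.toMonoidHom := ⟨d.1, d.2, rfl⟩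
  rwa [c.map_deltaTheta] at hd

/-- Transport of a function `f : Π^tp_{Ÿα} → (Δ_Θ)α` along `γ` and a theta companion:
`x ↦ γ^Θ(f(γ⁻¹ x))` on `Π^tp_{Ÿβ}` — "the isomorphism of cohomology groups induced by `γ`" (p. 24) at
the level of cocycles. [cite: MochizukiEtTh2009, Thm 1.6 (iii) p.24] -/
def transportFun {γ : Dα.PiTemp ≃ₜ* Dβ.PiTemp} (c : ThetaCompanion γ) (h : Thm16i γ)
    (f : Dα.GtpYdd → Dα.DeltaTheta) : Dβ.GtpYdd → Dβ.DeltaTheta := fun x =>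
  ⟨c.thetaIso (f ⟨γ.toMulEquiv.symm x.1, symm_mem_GtpYdd h x⟩).1, c.apply_mem _⟩

/-- The transport of a continuous cocycle along `(γ, γ^Θ)` is a continuous cocycle — so "the
isomorphism of cohomology groups induced by `γ`" (p. 24) is defined (PROVED from the compatibility
`(·)^Θ ∘ γ = γ^Θ ∘ (·)^Θ`). [cite: MochizukiEtTh2009, Thm 1.6 (iii) p.24] -/
theorem transportFun_mem {γ : Dα.PiTemp ≃ₜ* Dβ.PiTemp} (c : ThetaCompanion γ) (h : Thm16i γ)
    {f : Dα.GtpYdd → Dα.DeltaTheta} (hf : f ∈ contCocycles Dα.toTheta Dα.DeltaTheta Dα.GtpYdd) :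
    transportFun c h f ∈ contCocycles Dβ.toTheta Dβ.DeltaTheta Dβ.GtpYdd := by
  have hγs : Continuous fun x : Dβ.PiTemp => γ.toMulEquiv.symm x := γ.continuous_invFun
  refine ⟨?_, fun x y => ?_⟩
  · apply continuous_induced_rng.2
    change Continuous fun x : Dβ.GtpYdd =>
      (c.thetaIso.toMulEquiv (f ⟨γ.toMulEquiv.symm x.1, symm_mem_GtpYdd h x⟩).1 : Dβ.GtpTheta)
    exact (map_continuous c.thetaIso).comp (continuous_subtype_val.comp (hf.1.comp
      ((hγs.comp continuous_subtype_val).subtype_mk _)))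
  · have hxy : (⟨γ.toMulEquiv.symm (x * y).1, symm_mem_GtpYdd h (x * y)⟩ : Dα.GtpYdd) =
        ⟨γ.toMulEquiv.symm x.1, symm_mem_GtpYdd h x⟩ * ⟨γ.toMulEquiv.symm y.1, symm_mem_GtpYdd h y⟩ := by
      apply Subtype.ext
      simp only [Subgroup.coe_mul, MulMemClass.mk_mul_mk, map_mul]
    apply Subtype.ext
    change (c.thetaIso.toMulEquiv (f ⟨γ.toMulEquiv.symm (x * y).1, symm_mem_GtpYdd h (x * y)⟩).1 :
        Dβ.GtpTheta) =
      c.thetaIso.toMulEquiv (f ⟨γ.toMulEquiv.symm x.1, symm_mem_GtpYdd h x⟩).1 *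
        (Dβ.toTheta (x : Dβ.Gtp) *
          c.thetaIso.toMulEquiv (f ⟨γ.toMulEquiv.symm y.1, symm_mem_GtpYdd h y⟩).1 *
          (Dβ.toTheta (x : Dβ.Gtp))⁻¹)
    rw [hxy, hf.2]
    have hx : Dβ.toTheta (x : Dβ.Gtp) = c.thetaIso.toMulEquiv (Dα.toTheta (γ.toMulEquiv.symm x.1)) := by
      rw [← c.comm, MulEquiv.apply_symm_apply]
    simp only [Subgroup.coe_mul, MulAut.conjNormal_apply, map_mul, map_inv, hx]

/-- Transport of cocycles along `(γ, γ^Θ)` as a homomorphism. [cite: MochizukiEtTh2009, Thm 1.6 (iii) p.24] -/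
def transportCocycle {γ : Dα.PiTemp ≃ₜ* Dβ.PiTemp} (c : ThetaCompanion γ) (h : Thm16i γ) :
    contCocycles Dα.toTheta Dα.DeltaTheta Dα.GtpYdd →*
      contCocycles Dβ.toTheta Dβ.DeltaTheta Dβ.GtpYdd where
  toFun f := ⟨transportFun c h f.1, transportFun_mem c h f.2⟩
  map_one' := Subtype.ext (funext fun x => Subtype.ext (by
    change (c.thetaIso.toMulEquiv (1 : Dα.DeltaTheta).1 : Dβ.GtpTheta) = 1
    simp))
  map_mul' f g := Subtype.ext (funext fun x => Subtype.ext (by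
    change (c.thetaIso.toMulEquiv ((f.1 _ * g.1 _ : Dα.DeltaTheta)).1 : Dβ.GtpTheta) = _
    simp only [Subgroup.coe_mul, map_mul]
    rfl))

/-- **"The isomorphism of cohomology groups induced by `γ`"** (Thm. 1.6 (iii), p. 24):
`H¹(Π^tp_{Ÿα}, (Δ_Θ)α) → H¹(Π^tp_{Ÿβ}, (Δ_Θ)β)`, `[f] ↦ [γ^Θ ∘ f ∘ γ⁻¹]` — well defined (coboundaries go
to coboundaries; PROVED). [cite: MochizukiEtTh2009, Thm 1.6 (iii) p.24] -/
def transport {γ : Dα.PiTemp ≃ₜ* Dβ.PiTemp} (c : ThetaCompanion γ) (h : Thm16i γ) :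
    Dα.H1 Dα.GtpYdd →* Dβ.H1 Dβ.GtpYdd :=
  QuotientGroup.map _ _ (transportCocycle c h) (by
    intro f hf
    obtain ⟨a, ha⟩ := (mem_contCoboundaries_iff _).mp (Subgroup.mem_subgroupOf.mp hf)
    refine Subgroup.mem_subgroupOf.mpr ((mem_contCoboundaries_iff _).mpr
      ⟨⟨c.thetaIso.toMulEquiv a.1, c.apply_mem a⟩, ?_⟩)
    funext x
    have hx : Dβ.toTheta (x : Dβ.Gtp) = c.thetaIso.toMulEquiv (Dα.toTheta (γ.toMulEquiv.symm x.1)) := by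
      rw [← c.comm, MulEquiv.apply_symm_apply]
    apply Subtype.ext
    change (c.thetaIso.toMulEquiv (f.1 ⟨γ.toMulEquiv.symm x.1, symm_mem_GtpYdd h x⟩).1 : Dβ.GtpTheta) = _
    rw [congrFun ha ⟨γ.toMulEquiv.symm x.1, symm_mem_GtpYdd h x⟩]
    simp only [Subgroup.coe_mul, Subgroup.coe_inv, MulAut.conjNormal_apply, map_mul, map_inv, hx])

/-- A **uniformizer** of `K̈`: an element of `K̈` of absolute value `< 1` that is maximal among such
(generator of the maximal ideal of `O_K̈`; `K̈/ℚ_p` finite, p. 11) — "the elements `1 ∈ Ẑ`" of Thm. 1.6 (ii)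
are the images of uniformizers under `(K̈^×)^∧ ↠ Ẑ`. [cite: MochizukiEtTh2009, Thm 1.6 (ii) p.24] -/
def IsUniformizer (D : ThetaSetting p) (ϖ : (↥D.Kdd)ˣ) : Prop :=
  ‖((ϖ : D.Kdd) : PadicAlgCl p)‖ < 1 ∧
    ∀ x : D.Kdd, ‖(x : PadicAlgCl p)‖ < 1 → ‖(x : PadicAlgCl p)‖ ≤ ‖((ϖ : D.Kdd) : PadicAlgCl p)‖

/-- **Valuation data on `(K̈^×)^∧`** used by Thm. 1.6 (ii): "the surjections
`H¹(G_K̈, Δ_Θ) →̃ H¹(G_K̈, Ẑ(1)) →̃ (K̈^×)^∧ ↠ Ẑ` determined by the valuations on `K̈`" (p. 24) — carried as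
the KERNEL `unitsHat ≤ (K̈^×)^∧` of that surjection (the closure of `O^×_K̈`), with its printed relation
to `O^×_K̈`; `Ẑ` itself has no carrier here. [cite: MochizukiEtTh2009, Thm 1.6 (ii) p.24] -/
structure ValuationHatData (D : ThetaSetting p) (E : D.KummerData) where
  /-- `Ker((K̈^×)^∧ ↠ Ẑ)`, the completed unit group. -/
  unitsHat : Subgroup E.KddHat
  /-- `K̈^× ∩ Ker((K̈^×)^∧ ↠ Ẑ) = O^×_K̈`. -/
  mem_unitsHat_iff : ∀ a : (↥D.Kdd)ˣ, E.toKddHat a ∈ unitsHat ↔ a ∈ D.unitsOKdd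

/-- **Thm. 1.6 (ii)** (p. 24): "`γ` induces an isomorphism `(Δ_Θ)α →̃ (Δ_Θ)β` that is compatible with
the surjections `H¹(G_{K̈α}, (Δ_Θ)α) →̃ H¹(G_{K̈α}, Ẑ(1)) →̃ (K̈^×_α)^∧ ↠ Ẑ`,
`H¹(G_{K̈β}, (Δ_Θ)β) →̃ … ↠ Ẑ` determined by the valuations on `K̈α`, `K̈β`. That is to say, `γ` induces an
isomorphism `H¹(G_{K̈α}, (Δ_Θ)α) →̃ H¹(G_{K̈β}, (Δ_Θ)β)` that preserves both the kernel of these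
surjections and the elements `1 ∈ Ẑ` in the resulting quotients." Typed: there are a theta companion
`c` of `γ` and an isomorphism `δ : (K̈^×_α)^∧ →̃ (K̈^×_β)^∧` such that (a) `δ` IS the map induced by `γ`
on `F̈² ≅ (K̈^×)^∧` — the transport along `(γ, c)` of the Kummer class of `a` is the Kummer class of
`δ a`; (b) `δ` preserves the kernels `unitsHat`; (c) `δ` carries uniformizers to uniformizers modulo
the kernel ("the elements `1 ∈ Ẑ`"). [cite: MochizukiEtTh2009, Thm 1.6 (ii) p.24] -/
def Thm16ii (γ : Dα.PiTemp ≃ₜ* Dβ.PiTemp) (h : Thm16i γ) (Eα : Dα.KummerData) (Eβ : Dβ.KummerData)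
    (Vα : ValuationHatData Dα Eα) (Vβ : ValuationHatData Dβ Eβ) : Prop :=
  ∃ (c : ThetaCompanion γ) (δ : Eα.KddHat ≃* Eβ.KddHat),
    (∀ a : Eα.KddHat,
      transport c h (Dα.inflTheta Dα.GtpYdd (Eα.kumYdd a)) = Dβ.inflTheta Dβ.GtpYdd (Eβ.kumYdd (δ a))) ∧
    Vα.unitsHat.map δ.toMonoidHom = Vβ.unitsHat ∧
    ∀ ϖ : (↥Dα.Kdd)ˣ, IsUniformizer Dα ϖ →
      ∃ ϖ' : (↥Dβ.Kdd)ˣ, IsUniformizer Dβ ϖ' ∧ δ (Eα.toKddHat ϖ) * (Eβ.toKddHat ϖ')⁻¹ ∈ Vβ.unitsHat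

/-! ### Theorem 1.6 (iii) -/

/-- **Thm. 1.6 (iii) (Tempered Anabelian Rigidity of the Étale Theta Function)** (pp. 24–25): "The
isomorphism of cohomology groups induced by `γ` maps the classes `O^×_{K̈α} · η̈^Θ_α ∈ H¹(Π^tp_{Ÿα}, (Δ_Θ)α)`
of Proposition 1.3 for `Xα` to some `Π^tp_{Xβ}/Π^tp_{Yβ} ≅ Z`-conjugate of the corresponding classes
`O^×_{K̈β} · η̈^Θ_β ∈ H¹(Π^tp_{Ÿβ}, (Δ_Θ)β)` of Proposition 1.3 for `Xβ`." Typed with cocycle transport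
along `(γ, c)`: there is `σ ∈ Π^tp_{Xβ}` such that the transports of the theta classes of `α` are exactly
the `σ`-conjugates of the theta classes of `β`. [cite: MochizukiEtTh2009, Thm 1.6 (iii) p.24] -/
def Thm16iii (γ : Dα.PiTemp ≃ₜ* Dβ.PiTemp) (h : Thm16i γ) (c : ThetaCompanion γ)
    (Eα : Dα.EtaleThetaData) (Eβ : Dβ.EtaleThetaData) (hCβ : Dβ.Compat) : Prop :=
  haveI := hCβ.GtpYdd_normal
  ∃ σ : Dβ.PiTemp, transport c h '' Eα.thetaClasses =
    ContH1.conj Dβ.toTheta Dβ.DeltaTheta σ '' Eβ.thetaClasses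

/-! ### Remarks 1.6.1–1.6.4 (doc only)

**Remark 1.6.1** (p. 25): "In the proof of Theorem 1.6, (iii), we eliminated the 'indeterminacy' in
question by restricting to cusps, via the canonical integral structure. Another way to eliminate this
indeterminacy is to restrict to non-cuspidal torsion points, which are temp-absolute by [SemiAnbd],
Theorem 6.8, (iii)." — commentary on the proof; no decl.

**Remark 1.6.2** (pp. 25–26): "One way of thinking about isomorphisms of the tempered fundamental group
is that they arise from variation of the basepoint, or underlying set theory … The étale theta function
is preserved by arbitrary 'changes of the underlying set theory' …" — interpretation (analogy with the
functional equation of the complex theta function and `SL₂(ℤ)`); no decl.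

**Remark 1.6.3** (p. 26): "The interpretation of Theorem 1.6 given in Remark 1.6.2 is reminiscent of
the discussion given in the Introduction of [HASurI] …" — commentary; no decl.

**Remark 1.6.4** (p. 26): "there are [easier] profinite versions of the constructions given in the
present §1": the classes `O^×_K̈ · (η̈^Θ)^∧ ∈ H¹(Π_Ÿ^∧, Δ_Θ)` obtained by profinite completion, on which
`Π_X/Π_Y^∧ ≅ Ẑ ∋ a` acts via `(η̈^Θ)^∧ ↦ (η̈^Θ)^∧ − 2a · log(Ü) − (a²/2) · log(q_X) + log(O^×_K̈)`, and
which are preserved by any isomorphism `Π_{Xα} →̃ Π_{Xβ}`. A CLAIM, not typed here: it needs the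
profinite theta quotient `Π_X ↠ Π^Θ_X` acting on `Δ_Θ`, which the root file does not carry (only
`Π^tp_X ↠ (Π^tp_X)^Θ`); deferred to the merge with abc-iut-L3-t2's profinite-side data. -/

end ThetaSetting

end Literature.AnabelianGeometry.EtaleTheta

end
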